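import Summits.BirchSwinnertonDyer.Rank1Residual.GaloisImage.NineTorsionFixedPointWitness
import Summits.BirchSwinnertonDyer.Rank1Residual.GaloisImage.ThreeAdicTowerInertiaCriterion
import HarnessLib

/-!
# The ORBIT SOCKET at level `9`: `9 ∣ #ρ̄₉(H)` and an `H`-stable set of at most `8` points
# containing a point `Q₀` of order nine give a `3`-element of `H` fixing `Q₀`, hence the `3`-adic
# tower from surj(3)
# (cell `b2b-bsdres`, team n1011, seat p02 gen 4 — row T-b11 'm = 3: structure of the wild inertia
# on E[9]', file F1b; pure group theory over F1a, no reduction hypothesis)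

HONEST FRAMING (cell `b2b-bsdres`, run/shared/lean/b2b/bsd-rank1-residual/, verbatim in every
file): the goal of the cell is to DELETE the COMBINATION-SHAPED residual classes of the
Birch–Swinnerton-Dyer formula for ALL analytic-rank `≤ 1` elliptic curves over `ℚ` — "full BSD
formula for every rank `≤ 1` curve in class `C`" assembled STRICTLY from published theorems — so
that the rank-`≤ 1` remainder becomes exactly the CONSTRUCTION-SHAPED classes, which are TYPED
(missing-input `Prop`s), NOT attempted. This is not "finishing BSD". Team n1011 (N10 / N11):
research route; no claim beyond the stated classes; labels UNCHANGED; nothing is booked. Theorems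
only (no definition, no named fact).

## What this file proves

Let `E = W/ℚ`, `H ≤ Γ_ℚ` (in practice the inertia group `I_𝔓` at a prime over `3`) with
`9 ∣ #ρ̄_{E,9}(H)`, and let `Q₀ ∈ E[9]` lie in an `H`-STABLE finite set `S ⊆ E(ℚ̄)` with `#S ≤ 8`
(e.g. the points of `E[9]` whose abscissa has a prescribed valuation, when at most `4` abscissae
share it).  Then

* `exists_mem_fixed_pow_three_of_nine_dvd_card` (§1) — some `σ ∈ H` FIXES `Q₀` and acts on `E[9]`
  with order exactly `3` (`σ³ = 1 ≠ σ` there): the `H`-orbit of `Q₀` lies in `S`, so the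
  stabiliser `H_{Q₀}` has index `≤ 8` in `H` (`MulAction.index_stabilizer`); as
  `#ρ̄₉(H) = #ρ̄₉(H_{Q₀}) · [H : H_{Q₀}]` (`Subgroup.relIndex_inf_mul_relIndex`, `relIndex_ker`),
  `3 ∣ #ρ̄₉(H_{Q₀})`, and Cauchy (`exists_prime_orderOf_dvd_card'`) gives the element.
* `towerSurj_three_of_surj_of_nine_dvd_card_of_stable` (§2) — if moreover `Q₀` has order `9`
  (`3Q₀ ≠ 0`) and `ρ̄_{E,3}` is onto, then `ρ̄_{E,3ⁿ}` is onto for every `n` (F1a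
  `towerSurj_three_of_surj_of_pow_three_of_fixed`: such a `σ` is trivial on `E[3]` and non-scalar
  on `E[9]`, then n1011-p02 gen 2's Serre lifting lemma p252833);
  `imageContainsSL2_three_of_surj_of_nine_dvd_card_of_stable` (Kato (12.5.2));
  `lt_ncard_of_stable_of_surj_of_not_towerSurj` (contrapositive: on an EXOTIC row with
  `9 ∣ #ρ̄₉(H)`, every finite `H`-stable set containing a point of order `9` has `≥ 9` elements).

With F0 (`NineTorsionOrderNineWitness`: an element of order nine gives the tower) and the gen-2
count socket (`27 ∣ #ρ̄₉(H)` gives the tower, p254468) this is the kernel side of row T-b11's local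
DECISION at `v₃(j − 1728) = 3`: the `3`-adic factorisation type of `ψ₉/ψ₃` exhibits either an
inertia-stable abscissa class of size `≤ 4` (this file) or ramification index `27` (count socket),
unless the wild inertia on `E[9]` is the free `C₃ × C₃` ('type E').  Nothing booked; no label change.

References: [SerreAbelianLadic1968] Ch. IV §3.4 Lemma 3 (IV-23); [Serre1972] §4.1;
[Elkies2006] arXiv:math/0612734 §1; [Kato2004Asterisque] (12.5.2) p. 222.
-/

noncomputable section

open scoped Classical
open WeierstrassCurve Literature.NumberTheory.EllipticCurves

namespace Summit.BirchSwinnertonDyer.Rank1Residual.GaloisImage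

variable (W : WeierstrassCurve ℚ) [W.IsElliptic]

/-! ### §1 A `3`-element of `H` with a fixed point of order nine -/

/-- **Orbit socket.**  If `9 ∣ #ρ̄_{E,9}(H)` and `Q₀ ∈ E[9]` lies in an `H`-stable set of at most
`8` points, then some `σ ∈ H` fixes `Q₀` and acts on `E[9]` with order exactly `3`. [folklore] -/
theorem exists_mem_fixed_pow_three_of_nine_dvd_card (H : Subgroup (Field.absoluteGaloisGroup ℚ))
    (h9 : 9 ∣ Nat.card (H.map (galoisRepTorsion W 9))) {Q₀ : W.geomPoints}
    (hQ₀9 : Q₀ ∈ geomTorsion W 9) {S : Set W.geomPoints} (hSfin : S.Finite) (hS8 : S.ncard ≤ 8)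
    (hQ₀S : Q₀ ∈ S) (hstab : ∀ σ ∈ H, ∀ X ∈ S, σ • X ∈ S) :
    ∃ σ ∈ H, σ • Q₀ = Q₀ ∧ (∀ Q ∈ geomTorsion W 9, σ ^ 3 • Q = Q) ∧
      ∃ Q ∈ geomTorsion W 9, σ • Q ≠ Q := by
  haveI : Fact (Nat.Prime 3) := ⟨Nat.prime_three⟩
  set ρ := galoisRepTorsion W 9 with hρ
  set T : Subgroup (Field.absoluteGaloisGroup ℚ) :=
    MulAction.stabilizer (Field.absoluteGaloisGroup ℚ) Q₀ with hT
  -- `ker ρ̄₉ ≤ T` (elements trivial on `E[9]` fix `Q₀ ∈ E[9]`)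
  have hkerT : ρ.ker ≤ T := fun σ hσ ↦ by
    rw [hT, MulAction.mem_stabilizer_iff]
    exact congrArg Subtype.val ((galoisRepTorsion_eq_one_iff' W 9 σ).mp hσ ⟨Q₀, hQ₀9⟩)
  -- `#ρ̄₉(T ⊓ H) · [H : T ⊓ H] = #ρ̄₉(H)`
  have hmul : Nat.card ((T ⊓ H).map ρ) * T.relIndex H = Nat.card (H.map ρ) := by
    have h := Subgroup.relIndex_inf_mul_relIndex ρ.ker T H
    rwa [Subgroup.relIndex_ker, inf_eq_left.mpr hkerT, Subgroup.relIndex_ker] at h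
  -- `[H : T ⊓ H] = #(H-orbit of Q₀) ≤ #S ≤ 8`, and `> 0`
  have hsub : T.subgroupOf H = MulAction.stabilizer H Q₀ := by
    ext σ
    rw [Subgroup.mem_subgroupOf, hT, MulAction.mem_stabilizer_iff, MulAction.mem_stabilizer_iff]
    rfl
  have horb : MulAction.orbit H Q₀ ⊆ S := by
    rintro _ ⟨σ, rfl⟩
    exact hstab σ σ.2 Q₀ hQ₀S
  have hidx : T.relIndex H = (MulAction.orbit H Q₀).ncard := by
    rw [Subgroup.relIndex, hsub, MulAction.index_stabilizer]
  have hT8 : T.relIndex H ≤ 8 := by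
    rw [hidx]; exact (Set.ncard_le_ncard horb hSfin).trans hS8
  have hTpos : 0 < T.relIndex H := by
    rw [hidx]; exact (Set.ncard_pos (hSfin.subset horb)).mpr ⟨Q₀, MulAction.mem_orbit_self Q₀⟩
  -- hence `3 ∣ #ρ̄₉(T ⊓ H)`
  have h3 : 3 ∣ Nat.card ((T ⊓ H).map ρ) := by
    by_contra h3
    have hcop : Nat.Coprime 9 (Nat.card ((T ⊓ H).map ρ)) := by
      have : Nat.Coprime 3 (Nat.card ((T ⊓ H).map ρ)) :=
        (Nat.Prime.coprime_iff_not_dvd Nat.prime_three).mpr h3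
      simpa using this.pow_left 2
    have h9' : 9 ∣ Nat.card ((T ⊓ H).map ρ) * T.relIndex H := by rw [hmul]; exact h9
    have : 9 ∣ T.relIndex H := hcop.dvd_of_dvd_mul_left h9'
    omega
  -- the finite group `ρ̄₉(T ⊓ H)` has an element of order `3`
  have hpos : 0 < Nat.card (H.map ρ) := card_map_galoisRepTorsion_pos (W := W) H 9
  haveI : Finite ((T ⊓ H).map ρ) := Nat.finite_of_card_ne_zero (by
    intro h0; rw [h0, zero_mul] at hmul; omega)
  obtain ⟨x, hx⟩ := exists_prime_orderOf_dvd_card' 3 h3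
  obtain ⟨σ, hσTH, hσx⟩ := Subgroup.mem_map.mp x.2
  refine ⟨σ, hσTH.2, ?_, ?_, ?_⟩
  · -- `σ` fixes `Q₀`
    have hσT : σ ∈ T := hσTH.1
    rw [hT, MulAction.mem_stabilizer_iff] at hσT
    exact hσT
  · -- `σ³ = 1` on `E[9]`
    have hx3 : x ^ 3 = 1 := by rw [← hx]; exact pow_orderOf_eq_one x
    have hρ3 : ρ (σ ^ 3) = 1 := by
      rw [map_pow, hσx]; exact_mod_cast congrArg Subtype.val hx3
    intro Q hQ
    exact congrArg Subtype.val ((galoisRepTorsion_eq_one_iff' W 9 (σ ^ 3)).mp hρ3 ⟨Q, hQ⟩)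
  · -- `σ ≠ 1` on `E[9]`
    by_contra hall
    push Not at hall
    have hρ1 : ρ σ = 1 :=
      (galoisRepTorsion_eq_one_iff' W 9 σ).mpr fun P ↦ Subtype.ext (hall P P.2)
    have hx1 : x = 1 := Subtype.ext (by rw [← hσx, hρ1]; rfl)
    have h13 : orderOf x = 1 := by rw [hx1, orderOf_one]
    omega

/-! ### §2 The tower, Kato's (12.5.2), and the EXOTIC contrapositive -/

/-- **The `3`-adic tower from surj(3), `9 ∣ #ρ̄₉(H)`, and a small `H`-stable set around a point of
order nine.**  If `ρ̄_{E,3}` is onto, `9 ∣ #ρ̄_{E,9}(H)` for some `H ≤ Γ_ℚ`, and a point `Q₀` of order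
`9` lies in an `H`-stable set of at most `8` points, then `ρ̄_{E,3ⁿ}` is onto for every `n`.
[cite: SerreAbelianLadic1968, Ch. IV §3.4, Lemma 3 (IV-23)] [cite: Elkies2006, §1] -/
theorem towerSurj_three_of_surj_of_nine_dvd_card_of_stable (hsurj : W.HasSurjectiveModNGaloisRep 3)
    (H : Subgroup (Field.absoluteGaloisGroup ℚ)) (h9 : 9 ∣ Nat.card (H.map (galoisRepTorsion W 9)))
    {Q₀ : W.geomPoints} (hQ₀9 : Q₀ ∈ geomTorsion W 9) (h3Q₀ : (3 : ℕ) • Q₀ ≠ 0)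
    {S : Set W.geomPoints} (hSfin : S.Finite) (hS8 : S.ncard ≤ 8) (hQ₀S : Q₀ ∈ S)
    (hstab : ∀ σ ∈ H, ∀ X ∈ S, σ • X ∈ S) (n : ℕ) : W.HasSurjectiveModNGaloisRep (3 ^ n : ℕ) := by
  obtain ⟨σ, -, hfix, hσ3, hne⟩ :=
    exists_mem_fixed_pow_three_of_nine_dvd_card W H h9 hQ₀9 hSfin hS8 hQ₀S hstab
  exact towerSurj_three_of_surj_of_pow_three_of_fixed W hsurj σ hσ3 hne hQ₀9 hfix h3Q₀ n

/-- **Kato's (12.5.2) at `3`** from surj(3), `9 ∣ #ρ̄₉(H)`, and a small `H`-stable set around a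
point of order nine. [cite: Kato2004Asterisque, (12.5.2) (p. 222)] [cite: SerreAbelianLadic1968, Ch. IV §3.4, Lemma 3 (IV-23)] -/
theorem imageContainsSL2_three_of_surj_of_nine_dvd_card_of_stable
    (hsurj : W.HasSurjectiveModNGaloisRep 3) (H : Subgroup (Field.absoluteGaloisGroup ℚ))
    (h9 : 9 ∣ Nat.card (H.map (galoisRepTorsion W 9))) {Q₀ : W.geomPoints}
    (hQ₀9 : Q₀ ∈ geomTorsion W 9) (h3Q₀ : (3 : ℕ) • Q₀ ≠ 0) {S : Set W.geomPoints}
    (hSfin : S.Finite) (hS8 : S.ncard ≤ 8) (hQ₀S : Q₀ ∈ S) (hstab : ∀ σ ∈ H, ∀ X ∈ S, σ • X ∈ S) :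
    Kato2004.ImageContainsSL2 W 3 := by
  haveI : Fact (Nat.Prime 3) := ⟨Nat.prime_three⟩
  exact (Kato2004.imageContainsSL2_iff_forall_hasSurjectiveModNGaloisRep W 3).mpr
    (towerSurj_three_of_surj_of_nine_dvd_card_of_stable W hsurj H h9 hQ₀9 h3Q₀ hSfin hS8 hQ₀S hstab)

/-- **On an EXOTIC row small stable sets avoid the points of order nine**: if `ρ̄_{E,3}` is onto,
the `3`-adic tower fails at some level, and `9 ∣ #ρ̄_{E,9}(H)`, then every finite `H`-stable set
containing a point of order `9` has at least `9` elements. [cite: Elkies2006, §1–§2] -/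
theorem lt_ncard_of_stable_of_surj_of_not_towerSurj (hsurj : W.HasSurjectiveModNGaloisRep 3)
    (hnot : ¬ ∀ n : ℕ, W.HasSurjectiveModNGaloisRep (3 ^ n : ℕ))
    (H : Subgroup (Field.absoluteGaloisGroup ℚ)) (h9 : 9 ∣ Nat.card (H.map (galoisRepTorsion W 9)))
    {Q₀ : W.geomPoints} (hQ₀9 : Q₀ ∈ geomTorsion W 9) (h3Q₀ : (3 : ℕ) • Q₀ ≠ 0)
    {S : Set W.geomPoints} (hSfin : S.Finite) (hQ₀S : Q₀ ∈ S)
    (hstab : ∀ σ ∈ H, ∀ X ∈ S, σ • X ∈ S) : 8 < S.ncard := by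
  by_contra hle
  push Not at hle
  exact hnot (towerSurj_three_of_surj_of_nine_dvd_card_of_stable W hsurj H h9 hQ₀9 h3Q₀ hSfin hle
    hQ₀S hstab)

end Summit.BirchSwinnertonDyer.Rank1Residual.GaloisImage

end
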